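import Literature.Analysis.FluidPDE.NSCoriolisEnstrophy
import Literature.Analysis.FluidPDE.NSCoriolisGoodTimes
import Literature.Analysis.FunctionSpaces.TorusEnstrophyTrilinear
import HarnessLib

/-!
# `Ω`-uniform `H¹` a priori estimates for the rotating Navier–Stokes system on `T³`

Analysis/FluidPDE proof file (theorems only; no definitions, no named facts), sequel of
`NSCoriolisEnstrophy.lean` (the enstrophy equation of the rotating system carries no `Ω`),
`NSCoriolisGoodTimes.lean` (good times from the energy inequality) and
`FunctionSpaces/TorusEnstrophyTrilinear.lean` (`|b(u,u,Δu)| ≤ c‖∇u‖₂^{3/2}‖Δu‖₂^{3/2}`,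
FMRT 2001 (A.26b)), supporting the named fact
`Literature.Analysis.FluidPDE.bmn1999_rotating_ns_global_regularity` (Babin–Mahalov–Nicolaenko,
Indiana Univ. Math. J. 48 (1999), Thm. 1.1 = Thm. 5.3, the case `α = 1`, `F = 0`).

BMN 1999 work throughout with estimates that are **uniform in the rotation rate `Ω`** because
"`PJP` is skew-symmetric and commutes with `A^α`" (p. 1140); for `α = 1` this is the statement
that the enstrophy balance of a periodic classical solution `u` of
`∂ₜu + (u·∇)u + Ω e₃ × u = νΔu − ∇p`, `div u = 0`, is that of Navier–Stokes. Writing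
`G(t) = ‖∇u(t)‖₂²` (`Torus.gradNormSq`) and `L(t) = ‖Δu(t)‖₂²`, this file proves, for every
`ℤ³`-periodic classical solution of the unforced rotating system read on the torus and with
absolute constants (independent of `ν`, `Ω`, the solution and the time interval):

* `IsClassicalNSCoriolisSolutionOn.hasDerivWithinAt_torus_gradNormSq_le` — **the enstrophy
  inequality** `G' ≤ −ν L + C ν⁻³ G³` and `G' ≤ −(ν/27) G + C ν⁻³ G³` within `[a, b]`
  (enstrophy equation, the trilinear estimate in dissipation form, and `‖∇u‖₂² ≤ 27 ‖Δu‖₂²`);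
* `IsClassicalNSCoriolisSolutionOn.torus_gradNormSq_le_two_mul` — **the `Ω`-uniform local
  `H¹` bound** (the `α = 1` instance of BMN's "`T_α` independent of `Ω`", proof of Thm. 5.3,
  p. 1170, here in a priori form): `G(t) ≤ 2 G(a)` whenever `G(a)² (t − a) ≤ c ν³`;
* `IsClassicalNSCoriolisSolutionOn.torus_gradNormSq_le_of_le` — **small enstrophy does not
  grow**: if `G(a) < c ν²` then `G(t) ≤ G(s)` for `a ≤ s ≤ t ≤ b` (the classical small-data
  mechanism behind global regularity for `t ≥ T₀`, uniformly in `Ω`);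
* `IsClassicalNSCoriolisSolutionOn.torus_gradNormSq_lt_of_energy` — **eventual smallness,
  uniformly in `Ω`**: if the solution is classical on `[0, b]` and `T ≤ b` with
  `½‖u(0)‖₂² < c ν³ T`, then `G(t) < c ν²` for all `t ∈ [T, b]` (a good time in `[0, T]` by the
  energy inequality, BMN (5.41)–(5.45), then the previous item).
* `IsClassicalNSCoriolisSolutionOn.torus_gradNormSq_le_max_of_layer` — **global control =
  control of the initial layer**: for mean-zero `u(0)` and `T > ‖∇u(0)‖₂²/(8π²cν³)`, a bound
  `G ≤ B` on `[0, b] ∩ [0, T]` gives `G ≤ max B (cν²)` on all of `[0, b]` (the structure of BMN's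
  proof of Thm. 5.3 from Thm. 5.2; the layer bound for `Ω ≥ Ω₁` is the part not formalised).

The two comparison ("barrier") lemmas for real functions with a one-sided derivative that drive
the last three items are proved here in elementary form (`le_two_mul_of_deriv_right_le_cube`,
`le_init_of_deriv_right_neg`, from Mathlib's `image_le_of_deriv_right_lt_deriv_boundary'`).
What is NOT here is BMN's theorem proper: the `H¹` bound on the initial layer `[0, T⋆]` for
large data and `Ω ≥ Ω₁` (resonance analysis of the Poincaré propagator, §§3–5 of the paper),
and the local existence theory of classical solutions.

## Mathlib / tree search

Tree (reused): `IsClassicalNSCoriolisSolutionOn.hasDerivWithinAt_half_torus_gradNormSq`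
(`NSCoriolisEnstrophy`), `Torus.abs_integral_inner_convect_laplacian_le_dissipation`,
`Torus.gradNormSq_le_card_pow_mul_integral_norm_laplacian_sq` (`TorusEnstrophyTrilinear`),
`IsClassicalNSCoriolisSolutionOn.exists_mem_Icc_gradNormSq_le`, `torus_hasZeroMean`
(`NSCoriolisGoodTimes`, `NSCoriolisTorus`). Mathlib: `image_le_of_deriv_right_lt_deriv_boundary'`,
`Icc_mem_nhdsGE_of_mem`; no nonlinear ODE comparison in closed form (searched `Riccati`,
`deriv_right_lt_deriv_boundary` users).

## References

* A. Babin, A. Mahalov, B. Nicolaenko, *Global regularity of 3D rotating Navier–Stokes equations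
  for resonant domains*, Indiana Univ. Math. J. 48 (1999) 1133–1176: §2 p. 1140, §5 Thm. 5.1,
  (5.41)–(5.48), proof of Thm. 5.3 pp. 1170–1171. [BabinMahalovNicolaenko1999]
* C. Foias, O. Manley, R. Rosa, R. Temam, *Navier–Stokes Equations and Turbulence*, CUP 2001,
  Ch. II App. A (A.26b), and Ch. II §7 (enstrophy estimates in dimension 3).
  [FoiasManleyRosaTemam2001]
-/

noncomputable section

open MeasureTheory Set Function Filter Topology
open scoped ContDiff Laplacian InnerProductSpace RealInnerProductSpace NNReal

namespace Literature.Analysis.FluidPDE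

/-! ### Two comparison lemmas for one-sided derivatives -/

/-- **Cubic barrier.** Let `G` be continuous on `[a, b]` with right derivative `G'` on `[a, b)`
satisfying `G' ≤ k G³` (`k ≥ 0`), and `G(a) ≥ 0`. Then `G(t) ≤ 2 G(a)` for every `t ∈ [a, b]`
with `32 k G(a)² (t − a) ≤ 1`: compare `G` on `[a, t]` with the affine barrier
`B(x) = (G(a) + δ) + (G(a) + δ)(x − a)/(t − a)`, which stays below `2(G(a) + δ)` and has slope
exceeding `k B³` there (`image_le_of_deriv_right_lt_deriv_boundary'`), and let `δ → 0`.
[folklore] -/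
theorem le_two_mul_of_deriv_right_le_cube {G G' : ℝ → ℝ} {a b k : ℝ} (hk : 0 ≤ k)
    (hG : ContinuousOn G (Icc a b)) (hG' : ∀ x ∈ Ico a b, HasDerivWithinAt G (G' x) (Ici x) x)
    (hbound : ∀ x ∈ Ico a b, G' x ≤ k * G x ^ 3) (h0 : 0 ≤ G a) {t : ℝ} (ht : t ∈ Icc a b)
    (hsmall : 32 * k * G a ^ 2 * (t - a) ≤ 1) : G t ≤ 2 * G a := by
  rcases eq_or_lt_of_le ht.1 with hta | hta
  · rw [← hta]; linarith
  have htpos : 0 < t - a := sub_pos.2 hta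
  -- ### for every small `δ > 0`, `G t ≤ 2 (G a + δ)`
  have key : ∀ δ : ℝ, 0 < δ → 16 * k * δ ^ 2 * (t - a) < 1 / 2 → G t ≤ 2 * (G a + δ) := by
    intro δ hδ hδs
    set c : ℝ := G a + δ with hc
    have hcpos : 0 < c := by rw [hc]; linarith
    set lam : ℝ := c / (t - a) with hlam
    have hlampos : 0 < lam := div_pos hcpos htpos
    have hlamt : lam * (t - a) = c := by rw [hlam]; field_simp
    set B : ℝ → ℝ := fun x => c + lam * (x - a) with hB
    have hBcont : ContinuousOn B (Icc a t) :=
      (continuous_const.add (continuous_const.mul (continuous_id.sub continuous_const))).continuousOn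
    have hBderiv : ∀ x ∈ Ico a t, HasDerivWithinAt B ((fun _ => lam) x) (Ici x) x := by
      intro x _
      have h1 : HasDerivAt (fun y : ℝ => c + lam * (y - a)) (0 + lam * (1 - 0)) x :=
        (hasDerivAt_const x c).add (((hasDerivAt_id x).sub (hasDerivAt_const x a)).const_mul lam)
      have h2 : (0 : ℝ) + lam * (1 - 0) = lam := by ring
      rw [h2] at h1
      exact h1.hasDerivWithinAt
    have hGt : ContinuousOn G (Icc a t) := hG.mono (Icc_subset_Icc_right ht.2)
    have hG't : ∀ x ∈ Ico a t, HasDerivWithinAt G (G' x) (Ici x) x :=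
      fun x hx => hG' x ⟨hx.1, hx.2.trans_le ht.2⟩
    have hinit : G a ≤ B a := by
      simp only [hB, sub_self, mul_zero, add_zero, hc]
      linarith
    have h8 : 8 * k * c ^ 2 * (t - a) < 1 := by
      have hsq : c ^ 2 ≤ 2 * (G a ^ 2 + δ ^ 2) := by rw [hc]; nlinarith [sq_nonneg (G a - δ)]
      have hkt : 0 ≤ k * (t - a) := mul_nonneg hk htpos.le
      calc 8 * k * c ^ 2 * (t - a) = 8 * c ^ 2 * (k * (t - a)) := by ring
        _ ≤ 8 * (2 * (G a ^ 2 + δ ^ 2)) * (k * (t - a)) := by gcongr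
        _ = (32 * k * G a ^ 2 * (t - a)) / 2 + 16 * k * δ ^ 2 * (t - a) := by ring
        _ < 1 / 2 + 1 / 2 := by linarith
        _ = 1 := by norm_num
    have hcontact : ∀ x ∈ Ico a t, G x = B x → G' x < (fun _ => lam) x := by
      intro x hx hGB
      have hBx_le : B x ≤ 2 * c := by
        have h1 : lam * (x - a) ≤ lam * (t - a) :=
          mul_le_mul_of_nonneg_left (by linarith [hx.2]) hlampos.le
        simp only [hB]
        linarith
      have hBx_ge : 0 ≤ B x := by
        have h1 : 0 ≤ lam * (x - a) := mul_nonneg hlampos.le (sub_nonneg.2 hx.1)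
        simp only [hB]
        linarith
      have hb := hbound x ⟨hx.1, hx.2.trans_le ht.2⟩
      rw [hGB] at hb
      calc G' x ≤ k * B x ^ 3 := hb
        _ ≤ k * (2 * c) ^ 3 := by gcongr
        _ = 8 * k * c ^ 2 * (t - a) * lam := by rw [← hlamt]; ring
        _ < 1 * lam := mul_lt_mul_of_pos_right h8 hlampos
        _ = lam := one_mul _
    have hle := image_le_of_deriv_right_lt_deriv_boundary' hGt hG't (B := B) (B' := fun _ => lam)
      hinit hBcont hBderiv hcontact (right_mem_Icc.2 hta.le)
    calc G t ≤ B t := hle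
      _ = 2 * c := by simp only [hB]; linarith
  -- ### `δ → 0`
  by_contra hcon
  push Not at hcon
  have hden : 0 < 32 * k * (t - a) + 2 := by
    have : 0 ≤ 32 * k * (t - a) := by positivity
    linarith
  set δ : ℝ := min (1 / (32 * k * (t - a) + 2)) ((G t - 2 * G a) / 4) with hδ
  have hδpos : 0 < δ := lt_min (by positivity) (by linarith)
  have hδ1 : δ ≤ 1 / (32 * k * (t - a) + 2) := min_le_left _ _
  have hδ2 : δ ≤ (G t - 2 * G a) / 4 := min_le_right _ _
  have hδs : 16 * k * δ ^ 2 * (t - a) < 1 / 2 := by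
    have hδle1 : δ ≤ 1 := by
      refine hδ1.trans ?_
      rw [div_le_one hden]
      have : 0 ≤ 32 * k * (t - a) := by positivity
      linarith
    have hδsq : δ ^ 2 ≤ δ := by nlinarith
    have hkt : 0 ≤ 16 * k * (t - a) := by positivity
    calc 16 * k * δ ^ 2 * (t - a) = (16 * k * (t - a)) * δ ^ 2 := by ring
      _ ≤ (16 * k * (t - a)) * δ := mul_le_mul_of_nonneg_left hδsq hkt
      _ ≤ (16 * k * (t - a)) * (1 / (32 * k * (t - a) + 2)) := mul_le_mul_of_nonneg_left hδ1 hkt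
      _ < 1 / 2 := by
          rw [mul_one_div, div_lt_iff₀ hden]
          linarith
  have := key δ hδpos hδs
  linarith

/-- **Constant barrier.** Let `G` be continuous on `[a, b]` with right derivative `G'` on
`[a, b)`, and suppose `G' < 0` at every point where `G(a) < G < M`, with `G(a) < M`. Then
`G(t) ≤ G(a)` on `[a, b]` (compare with the constants `c ∈ (G(a), M)` and let `c → G(a)`).
[folklore] -/
theorem le_init_of_deriv_right_neg {G G' : ℝ → ℝ} {a b M : ℝ}
    (hG : ContinuousOn G (Icc a b)) (hG' : ∀ x ∈ Ico a b, HasDerivWithinAt G (G' x) (Ici x) x)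
    (hneg : ∀ x ∈ Ico a b, G a < G x → G x < M → G' x < 0) (haM : G a < M) :
    ∀ t ∈ Icc a b, G t ≤ G a := by
  intro t ht
  have key : ∀ c, G a < c → c < M → G t ≤ c := by
    intro c hac hcM
    have h := image_le_of_deriv_right_lt_deriv_boundary' hG hG' (B := fun _ => c) (B' := fun _ => 0)
      hac.le continuousOn_const (fun x _ => hasDerivWithinAt_const x (Ici x) c)
      (fun x hx hGc => by
        have h1 : G a < G x := by rw [hGc]; exact hac
        have h2 : G x < M := by rw [hGc]; exact hcM
        exact hneg x hx h1 h2) ht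
    exact h
  by_contra hcon
  push Not at hcon
  set c : ℝ := min ((G a + G t) / 2) ((G a + M) / 2) with hc
  have h1 : G a < c := lt_min (by linarith) (by linarith)
  have h2 : c < M := (min_le_right _ _).trans_lt (by linarith)
  have h3 : c < G t := (min_le_left _ _).trans_lt (by linarith)
  exact absurd (key c h1 h2) (not_le.2 h3)

/-! ### The enstrophy inequality of the rotating system, uniformly in `Ω` -/

namespace IsClassicalNSCoriolisSolutionOn

/-- **The `Ω`-uniform enstrophy inequality.** There is an absolute constant `C ≥ 1` such that
for every `ν > 0`, every `Ω`, and every periodic classical solution of the unforced rotating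
Navier–Stokes system on `ℝ³ × [a, b]`, `a < b`, the enstrophy `G(t) = ‖∇u(t)‖₂²` has a
one-sided derivative `G'(t)` within `[a, b]` at every `t ∈ [a, b]` with
`G'(t) ≤ −ν ‖Δu(t)‖₂² + C ν⁻³ G(t)³` and `G'(t) ≤ −(ν/27) G(t) + C ν⁻³ G(t)³` — no `Ω`
(BMN 1999, p. 1140 and §5, the `α = 1` estimates; FMRT 2001, Ch. II §7): the enstrophy
equation `½G' = −ν‖Δu‖² + ∫⟪(u·∇)u, Δu⟫` (`hasDerivWithinAt_half_torus_gradNormSq`), the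
trilinear estimate `|∫⟪(u·∇)u, Δu⟫| ≤ (ν/2)‖Δu‖² + 8K⁴ν⁻³G³`
(`Torus.abs_integral_inner_convect_laplacian_le_dissipation`) and `G ≤ 27 ‖Δu‖₂²`
(`Torus.gradNormSq_le_card_pow_mul_integral_norm_laplacian_sq`).
[cite: BabinMahalovNicolaenko1999, §2 p. 1140 with §5 (5.46)–(5.48)] -/
theorem hasDerivWithinAt_torus_gradNormSq_le :
    ∃ C : ℝ, 1 ≤ C ∧ ∀ {ν Ω a b : ℝ} {u : ℝ → UnitAddTorus (Fin 3) → EuclideanSpace ℝ (Fin 3)}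
      {p : ℝ → UnitAddTorus (Fin 3) → ℝ}, 0 < ν → a < b →
      IsClassicalNSCoriolisSolutionOn (Icc a b) ν Ω 0 (fun t => FunctionSpaces.Torus.lift (u t))
        (fun t => FunctionSpaces.Torus.lift (p t)) →
      ∀ t ∈ Icc a b, ∃ D : ℝ,
        HasDerivWithinAt (fun s => FunctionSpaces.Torus.gradNormSq (u s)) D (Icc a b) t ∧
        D ≤ -ν * (∫ x, ‖FunctionSpaces.Torus.laplacian (u t) x‖ ^ 2) +
          C / ν ^ 3 * FunctionSpaces.Torus.gradNormSq (u t) ^ 3 ∧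
        D ≤ -(ν / 27) * FunctionSpaces.Torus.gradNormSq (u t) +
          C / ν ^ 3 * FunctionSpaces.Torus.gradNormSq (u t) ^ 3 := by
  obtain ⟨K, hK⟩ := FunctionSpaces.Torus.abs_integral_inner_convect_laplacian_le_dissipation
    (d := Fin 3) (by simp)
  refine ⟨16 * (K : ℝ) ^ 4 + 1, by linarith [pow_nonneg (NNReal.coe_nonneg K) 4], ?_⟩
  intro ν Ω a b u p hν hab h t ht
  have h0 : IsClassicalNSCoriolisSolutionOn (Icc a b) ν Ω
      (fun t => FunctionSpaces.Torus.lift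
        ((0 : ℝ → UnitAddTorus (Fin 3) → EuclideanSpace ℝ (Fin 3)) t))
      (fun t => FunctionSpaces.Torus.lift (u t)) (fun t => FunctionSpaces.Torus.lift (p t)) := h
  have hT := h0.to_torus
  have hut : FunctionSpaces.Torus.IsSmooth (u t) := hT.smooth_velocity.isSmooth_slice ht
  have hdiv : FunctionSpaces.Torus.IsDivFree (u t) := hT.divFree t ht
  set G : ℝ := FunctionSpaces.Torus.gradNormSq (u t) with hG
  set L : ℝ := ∫ x, ‖FunctionSpaces.Torus.laplacian (u t) x‖ ^ 2 with hL
  set N : ℝ := ∫ x, ⟪FunctionSpaces.Torus.convect (u t) (u t) x,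
    FunctionSpaces.Torus.laplacian (u t) x⟫ with hN
  have hG0 : 0 ≤ G := FunctionSpaces.Torus.gradNormSq_nonneg _
  have hL0 : 0 ≤ L := integral_nonneg fun x => sq_nonneg _
  -- the enstrophy equation (no `Ω`), doubled
  have hd := h0.hasDerivWithinAt_half_torus_gradNormSq hab ht
  simp only [Pi.zero_apply, sub_zero] at hd
  have hd2 := hd.const_mul (2 : ℝ)
  have hfun : (fun s => (2 : ℝ) * (2⁻¹ * FunctionSpaces.Torus.gradNormSq (u s))) =
      fun s => FunctionSpaces.Torus.gradNormSq (u s) := by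
    funext s; ring
  rw [hfun] at hd2
  refine ⟨2 * (-ν * L + N), hd2, ?_, ?_⟩
  · -- `2(−νL + N) ≤ −νL + 16K⁴ν⁻³G³ ≤ −νL + Cν⁻³G³`
    have hNb : N ≤ ν / 2 * L + 8 * (K : ℝ) ^ 4 / ν ^ 3 * G ^ 3 :=
      (le_abs_self N).trans (hK ν hν (u t) hut hdiv)
    have hC : 16 * (K : ℝ) ^ 4 / ν ^ 3 * G ^ 3 ≤ (16 * (K : ℝ) ^ 4 + 1) / ν ^ 3 * G ^ 3 := by
      gcongr
      linarith
    calc 2 * (-ν * L + N) ≤ 2 * (-ν * L + (ν / 2 * L + 8 * (K : ℝ) ^ 4 / ν ^ 3 * G ^ 3)) := by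
          gcongr
      _ = -ν * L + 16 * (K : ℝ) ^ 4 / ν ^ 3 * G ^ 3 := by ring
      _ ≤ -ν * L + (16 * (K : ℝ) ^ 4 + 1) / ν ^ 3 * G ^ 3 := by linarith
  · -- with `G ≤ 27 L`
    have hNb : N ≤ ν / 2 * L + 8 * (K : ℝ) ^ 4 / ν ^ 3 * G ^ 3 :=
      (le_abs_self N).trans (hK ν hν (u t) hut hdiv)
    have hP : G ≤ 27 * L := by
      have h := FunctionSpaces.Torus.gradNormSq_le_card_pow_mul_integral_norm_laplacian_sq hut
      simp only [Fintype.card_fin] at h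
      norm_num at h
      exact h
    have hC : 16 * (K : ℝ) ^ 4 / ν ^ 3 * G ^ 3 ≤ (16 * (K : ℝ) ^ 4 + 1) / ν ^ 3 * G ^ 3 := by
      gcongr
      linarith
    calc 2 * (-ν * L + N) ≤ 2 * (-ν * L + (ν / 2 * L + 8 * (K : ℝ) ^ 4 / ν ^ 3 * G ^ 3)) := by
          gcongr
      _ = -ν * L + 16 * (K : ℝ) ^ 4 / ν ^ 3 * G ^ 3 := by ring
      _ ≤ -(ν / 27) * G + 16 * (K : ℝ) ^ 4 / ν ^ 3 * G ^ 3 := by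
          have := mul_le_mul_of_nonneg_left hP hν.le
          linarith
      _ ≤ -(ν / 27) * G + (16 * (K : ℝ) ^ 4 + 1) / ν ^ 3 * G ^ 3 := by linarith

/-- **The `Ω`-uniform local `H¹` bound** (the case `α = 1` of BMN 1999's "`T_α` independent of
`Ω`", proof of Thm. 5.3, p. 1170, and of Thm. 5.1: local `H¹` control on a time depending only on
`‖∇u(a)‖₂` and `ν`), in a priori form: there is an absolute constant `c > 0` such that for every
`ν > 0`, every `Ω`, and every periodic classical solution of the unforced rotating system on
`ℝ³ × [a, b]`, `‖∇u(t)‖₂² ≤ 2 ‖∇u(a)‖₂²` for all `t ∈ [a, b]` with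
`(‖∇u(a)‖₂²)² (t − a) ≤ c ν³`. Proof: the enstrophy inequality `G' ≤ C ν⁻³ G³` and the cubic
barrier `le_two_mul_of_deriv_right_le_cube`. [cite: BabinMahalovNicolaenko1999, Thm. 5.1 and proof of Thm. 5.3 (p. 1170)] -/
theorem torus_gradNormSq_le_two_mul :
    ∃ c : ℝ, 0 < c ∧ ∀ {ν Ω a b : ℝ} {u : ℝ → UnitAddTorus (Fin 3) → EuclideanSpace ℝ (Fin 3)}
      {p : ℝ → UnitAddTorus (Fin 3) → ℝ}, 0 < ν →
      IsClassicalNSCoriolisSolutionOn (Icc a b) ν Ω 0 (fun t => FunctionSpaces.Torus.lift (u t))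
        (fun t => FunctionSpaces.Torus.lift (p t)) →
      ∀ t ∈ Icc a b, FunctionSpaces.Torus.gradNormSq (u a) ^ 2 * (t - a) ≤ c * ν ^ 3 →
        FunctionSpaces.Torus.gradNormSq (u t) ≤ 2 * FunctionSpaces.Torus.gradNormSq (u a) := by
  classical
  obtain ⟨C, hC1, hC⟩ := hasDerivWithinAt_torus_gradNormSq_le
  have hCpos : 0 < C := by linarith
  refine ⟨1 / (32 * C), by positivity, ?_⟩
  intro ν Ω a b u p hν h t ht hsmall
  rcases le_or_gt b a with hba | hab
  · -- degenerate interval: `t = a`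
    have hta : t = a := le_antisymm (ht.2.trans hba) ht.1
    rw [hta]
    linarith [FunctionSpaces.Torus.gradNormSq_nonneg (u a)]
  -- the derivative and its bound at every point of `[a, b]`
  choose D hD using fun s (hs : s ∈ Icc a b) => hC hν hab h s hs
  have hderiv : ∀ s (hs : s ∈ Icc a b), HasDerivWithinAt (fun s => FunctionSpaces.Torus.gradNormSq (u s))
      ((fun s => if hs : s ∈ Icc a b then D s hs else 0) s) (Icc a b) s := by
    intro s hs
    simp only [dif_pos hs]
    exact (hD s hs).1
  have hcont : ContinuousOn (fun s => FunctionSpaces.Torus.gradNormSq (u s)) (Icc a b) :=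
    fun s hs => (hderiv s hs).continuousWithinAt
  have hderiv' : ∀ s ∈ Ico a b, HasDerivWithinAt (fun s => FunctionSpaces.Torus.gradNormSq (u s))
      ((fun s => if hs : s ∈ Icc a b then D s hs else 0) s) (Ici s) s := fun s hs =>
    (hderiv s (mem_Icc_of_Ico hs)).mono_of_mem_nhdsWithin (Icc_mem_nhdsGE_of_mem hs)
  have hbound : ∀ s ∈ Ico a b, (fun s => if hs : s ∈ Icc a b then D s hs else 0) s ≤
      C / ν ^ 3 * (fun s => FunctionSpaces.Torus.gradNormSq (u s)) s ^ 3 := by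
    intro s hs
    have h1 := (hD s (mem_Icc_of_Ico hs)).2.1
    simp only [dif_pos (mem_Icc_of_Ico hs)]
    have hL0 : 0 ≤ ∫ x, ‖FunctionSpaces.Torus.laplacian (u s) x‖ ^ 2 := integral_nonneg fun x => sq_nonneg _
    have : -ν * (∫ x, ‖FunctionSpaces.Torus.laplacian (u s) x‖ ^ 2) ≤ 0 := by nlinarith
    linarith
  have hk : 0 ≤ C / ν ^ 3 := by positivity
  refine le_two_mul_of_deriv_right_le_cube hk hcont hderiv' hbound
    (FunctionSpaces.Torus.gradNormSq_nonneg (u a)) ht ?_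
  -- `32 (C/ν³) G(a)² (t − a) ≤ 1` from `G(a)² (t − a) ≤ ν³/(32C)`
  have hν3 : 0 < ν ^ 3 := pow_pos hν 3
  have h1 : FunctionSpaces.Torus.gradNormSq (u a) ^ 2 * (t - a) ≤ ν ^ 3 / (32 * C) := by
    rw [show 1 / (32 * C) * ν ^ 3 = ν ^ 3 / (32 * C) by ring] at hsmall
    exact hsmall
  rw [le_div_iff₀ (by positivity)] at h1
  calc 32 * (C / ν ^ 3) * FunctionSpaces.Torus.gradNormSq (u a) ^ 2 * (t - a)
      = (FunctionSpaces.Torus.gradNormSq (u a) ^ 2 * (t - a) * (32 * C)) / ν ^ 3 := by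
        field_simp
    _ ≤ ν ^ 3 / ν ^ 3 := by gcongr
    _ = 1 := div_self hν3.ne'

/-- **Small enstrophy does not grow, uniformly in `Ω`** (the small-data mechanism of global
regularity, BMN 1999 proof of Thm. 5.3 and [9] Thm. 8.2; FMRT 2001, Ch. II §7): there is an
absolute constant `c > 0` such that for every `ν > 0`, every `Ω`, and every periodic classical
solution of the unforced rotating system on `ℝ³ × [a, b]` with `‖∇u(a)‖₂² < c ν²`, the
enstrophy is non-increasing: `‖∇u(t)‖₂² ≤ ‖∇u(s)‖₂²` for `a ≤ s ≤ t ≤ b`. Proof: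
`G' ≤ −(ν/27)G + Cν⁻³G³ < 0` while `0 < G < ν²/(27C)`, and the constant barrier
`le_init_of_deriv_right_neg` (twice). [cite: BabinMahalovNicolaenko1999, proof of Thm. 5.3 (pp. 1170–1171)] -/
theorem torus_gradNormSq_le_of_le :
    ∃ c : ℝ, 0 < c ∧ ∀ {ν Ω a b : ℝ} {u : ℝ → UnitAddTorus (Fin 3) → EuclideanSpace ℝ (Fin 3)}
      {p : ℝ → UnitAddTorus (Fin 3) → ℝ}, 0 < ν →
      IsClassicalNSCoriolisSolutionOn (Icc a b) ν Ω 0 (fun t => FunctionSpaces.Torus.lift (u t))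
        (fun t => FunctionSpaces.Torus.lift (p t)) →
      FunctionSpaces.Torus.gradNormSq (u a) < c * ν ^ 2 →
      ∀ {s t : ℝ}, s ∈ Icc a b → t ∈ Icc a b → s ≤ t →
        FunctionSpaces.Torus.gradNormSq (u t) ≤ FunctionSpaces.Torus.gradNormSq (u s) := by
  classical
  obtain ⟨C, hC1, hC⟩ := hasDerivWithinAt_torus_gradNormSq_le
  have hCpos : 0 < C := by linarith
  refine ⟨1 / (27 * C), by positivity, ?_⟩
  intro ν Ω a b u p hν h hsmall s t hs ht hst
  rcases le_or_gt b a with hba | hab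
  · have hsa : s = a := le_antisymm (hs.2.trans hba) hs.1
    have hta : t = a := le_antisymm (ht.2.trans hba) ht.1
    rw [hsa, hta]
  set M : ℝ := 1 / (27 * C) * ν ^ 2 with hM
  have hMpos : 0 < M := by positivity
  choose D hD using fun s (hs : s ∈ Icc a b) => hC hν hab h s hs
  have hderiv : ∀ s (hs : s ∈ Icc a b), HasDerivWithinAt (fun s => FunctionSpaces.Torus.gradNormSq (u s))
      ((fun s => if hs : s ∈ Icc a b then D s hs else 0) s) (Icc a b) s := by
    intro s hs
    simp only [dif_pos hs]
    exact (hD s hs).1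
  have hcont : ContinuousOn (fun s => FunctionSpaces.Torus.gradNormSq (u s)) (Icc a b) :=
    fun s hs => (hderiv s hs).continuousWithinAt
  -- the sign of the derivative while `0 < G < M`
  have h27C : (1 : ℝ) ≤ 27 * C := by linarith
  have hM2 : M ^ 2 ≤ ν ^ 4 / (27 * C) := by
    rw [hM]
    have e : (1 / (27 * C) * ν ^ 2) ^ 2 = ν ^ 4 / ((27 * C) * (27 * C)) := by
      field_simp
    rw [e]
    exact div_le_div_of_nonneg_left (by positivity) (by positivity) (by nlinarith)
  have hneg : ∀ x ∈ Ico a b, 0 < FunctionSpaces.Torus.gradNormSq (u x) →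
      FunctionSpaces.Torus.gradNormSq (u x) < M →
      (fun s => if hs : s ∈ Icc a b then D s hs else 0) x < 0 := by
    intro x hx hGpos hGM
    have h1 := (hD x (mem_Icc_of_Ico hx)).2.2
    simp only [dif_pos (mem_Icc_of_Ico hx)]
    -- `C/ν³ G³ < (ν/27) G` since `G² < M² ≤ ν⁴/(27C)`
    have hG2 : FunctionSpaces.Torus.gradNormSq (u x) ^ 2 < M ^ 2 := pow_lt_pow_left₀ hGM hGpos.le two_ne_zero
    have hkey : C / ν ^ 3 * FunctionSpaces.Torus.gradNormSq (u x) ^ 3 <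
        ν / 27 * FunctionSpaces.Torus.gradNormSq (u x) := by
      have e1 : C / ν ^ 3 * FunctionSpaces.Torus.gradNormSq (u x) ^ 3 =
          (C / ν ^ 3 * FunctionSpaces.Torus.gradNormSq (u x) ^ 2) * FunctionSpaces.Torus.gradNormSq (u x) := by
        ring
      rw [e1]
      refine mul_lt_mul_of_pos_right ?_ hGpos
      calc C / ν ^ 3 * FunctionSpaces.Torus.gradNormSq (u x) ^ 2 < C / ν ^ 3 * M ^ 2 := by gcongr
        _ ≤ C / ν ^ 3 * (ν ^ 4 / (27 * C)) := by gcongr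
        _ = ν / 27 := by field_simp
    linarith
  -- first from `a`: `G ≤ G a` on `[a, b]`
  have hGa0 : 0 ≤ FunctionSpaces.Torus.gradNormSq (u a) := FunctionSpaces.Torus.gradNormSq_nonneg (u a)
  have hfromA : ∀ x ∈ Icc a b, FunctionSpaces.Torus.gradNormSq (u x) ≤ FunctionSpaces.Torus.gradNormSq (u a) :=
    le_init_of_deriv_right_neg (M := M) hcont
      (fun x hx => (hderiv x (mem_Icc_of_Ico hx)).mono_of_mem_nhdsWithin (Icc_mem_nhdsGE_of_mem hx))
      (fun x hx hax hxM => hneg x hx (hGa0.trans_lt hax) hxM) hsmall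
  -- then from `s`: `G ≤ G s` on `[s, b]`
  rcases eq_or_lt_of_le hst with hst' | hst'
  · rw [hst']
  have hsub : Icc s b ⊆ Icc a b := Icc_subset_Icc_left hs.1
  have hcont' : ContinuousOn (fun s => FunctionSpaces.Torus.gradNormSq (u s)) (Icc s b) := hcont.mono hsub
  have hderiv'' : ∀ x ∈ Ico s b, HasDerivWithinAt (fun s => FunctionSpaces.Torus.gradNormSq (u s))
      ((fun s => if hs : s ∈ Icc a b then D s hs else 0) x) (Ici x) x := fun x hx =>
    ((hderiv x (hsub (mem_Icc_of_Ico hx))).mono hsub).mono_of_mem_nhdsWithin (Icc_mem_nhdsGE_of_mem hx)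
  have hGs0 : 0 ≤ FunctionSpaces.Torus.gradNormSq (u s) := FunctionSpaces.Torus.gradNormSq_nonneg (u s)
  have hsM : FunctionSpaces.Torus.gradNormSq (u s) < M := (hfromA s hs).trans_lt hsmall
  have hfromS : ∀ x ∈ Icc s b, FunctionSpaces.Torus.gradNormSq (u x) ≤ FunctionSpaces.Torus.gradNormSq (u s) :=
    le_init_of_deriv_right_neg (M := M) hcont' hderiv''
      (fun x hx hsx hxM => hneg x ⟨hs.1.trans hx.1, hx.2⟩ (hGs0.trans_lt hsx) hxM) hsM
  exact hfromS t ⟨hst, ht.2⟩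

/-- **Eventual smallness of the enstrophy, uniformly in `Ω`** (the a priori content of the last
step of BMN 1999's proof of Thm. 5.3, pp. 1170–1171: by the energy inequality (5.41)–(5.45) every
time window of length `τ` contains a good time `t⋆` with `‖∇u(t⋆)‖₂² ≤ ½‖u(0)‖₂²/(ντ)`, after
which small data stay small): with the constant `c` of `torus_gradNormSq_le_of_le`, for every
`ν > 0`, every `Ω`, and every periodic classical solution of the unforced rotating system on
`ℝ³ × [0, b]`, if `T > 0` satisfies `½‖u(0)‖₂² < c ν³ T` and `T ≤ b`, then
`‖∇u(t)‖₂² < c ν²` for every `t ∈ [T, b]` (no mean-zero condition is needed: the energy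
inequality and the enstrophy estimates hold for every periodic classical solution).
[cite: BabinMahalovNicolaenko1999, proof of Thm. 5.3 (pp. 1170–1171) with (5.41)–(5.45)] -/
theorem torus_gradNormSq_lt_of_energy :
    ∃ c : ℝ, 0 < c ∧ ∀ {ν Ω b T : ℝ} {u : ℝ → UnitAddTorus (Fin 3) → EuclideanSpace ℝ (Fin 3)}
      {p : ℝ → UnitAddTorus (Fin 3) → ℝ}, 0 < ν →
      IsClassicalNSCoriolisSolutionOn (Icc 0 b) ν Ω 0 (fun t => FunctionSpaces.Torus.lift (u t))
        (fun t => FunctionSpaces.Torus.lift (p t)) →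
      0 < T → T ≤ b → FunctionSpaces.Torus.kineticEnergy (u 0) < c * ν ^ 3 * T →
      ∀ t ∈ Icc T b, FunctionSpaces.Torus.gradNormSq (u t) < c * ν ^ 2 := by
  obtain ⟨c, hc, hmono⟩ := torus_gradNormSq_le_of_le
  refine ⟨c, hc, ?_⟩
  intro ν Ω b T u p hν h hT hTb hE t ht
  -- a good time in `[0, T]`
  obtain ⟨t', ht', hle⟩ := h.exists_mem_Icc_gradNormSq_le hν (convex_Icc 0 b) hT
    (Icc_subset_Icc_right hTb)
  have hsmall : FunctionSpaces.Torus.gradNormSq (u t') < c * ν ^ 2 := by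
    refine hle.trans_lt ?_
    rw [sub_zero, div_lt_iff₀ (mul_pos hν hT)]
    calc FunctionSpaces.Torus.kineticEnergy (u 0) < c * ν ^ 3 * T := hE
      _ = c * ν ^ 2 * (ν * T) := by ring
  -- restart the monotonicity from `t'`
  rcases eq_or_lt_of_le (ht'.2.trans hTb) with hb | hb
  · -- `t' = b`: then `t = t'`
    have htt' : t = t' := le_antisymm (ht.2.trans_eq hb.symm) (ht'.2.trans ht.1)
    rw [htt']
    exact hsmall
  have hsub : Icc t' b ⊆ Icc 0 b := Icc_subset_Icc_left ht'.1
  have h' : IsClassicalNSCoriolisSolutionOn (Icc t' b) ν Ω 0 (fun t => FunctionSpaces.Torus.lift (u t))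
      (fun t => FunctionSpaces.Torus.lift (p t)) := h.mono hsub (uniqueDiffOn_Icc hb)
  have htI : t ∈ Icc t' b := ⟨ht'.2.trans ht.1, ht.2⟩
  have hle' := hmono hν h' hsmall (left_mem_Icc.2 hb.le) htI htI.1
  exact hle'.trans_lt hsmall

/-- **Global `H¹` control = control of the initial layer, uniformly in `Ω`** (the structure of
BMN 1999's proof of Thm. 5.3 from Thm. 5.2, pp. 1170–1171, in a priori form): with the constant
`c` of `torus_gradNormSq_lt_of_energy`, for every `ν > 0`, every `Ω`, every periodic classical
solution of the unforced rotating system on `ℝ³ × [0, b]` with mean-zero `u(0)`, and every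
`T > ‖∇u(0)‖₂² / (8π² c ν³)`: if `‖∇u(t)‖₂² ≤ B` on the initial layer `t ∈ [0, b] ∩ [0, T]`, then
`‖∇u(t)‖₂² ≤ max B (c ν²)` for **all** `t ∈ [0, b]` (Poincaré `½‖u(0)‖₂² ≤ ‖∇u(0)‖₂²/(8π²)`,
`Torus.integral_norm_sq_le_gradNormSq_of_hasZeroMean`, makes `T` an admissible time for
`torus_gradNormSq_lt_of_energy`). What BMN prove for `Ω ≥ Ω₁(M, ν)` — and what is not formalised
— is the layer bound with `T`, `B` depending only on `M ≥ ‖∇u(0)‖₂` and `ν` (Thm. 5.2), together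
with the existence of the regular solution. [cite: BabinMahalovNicolaenko1999, proof of Thm. 5.3 (pp. 1170–1171)] -/
theorem torus_gradNormSq_le_max_of_layer :
    ∃ c : ℝ, 0 < c ∧ ∀ {ν Ω b T B : ℝ} {u : ℝ → UnitAddTorus (Fin 3) → EuclideanSpace ℝ (Fin 3)}
      {p : ℝ → UnitAddTorus (Fin 3) → ℝ}, 0 < ν →
      IsClassicalNSCoriolisSolutionOn (Icc 0 b) ν Ω 0 (fun t => FunctionSpaces.Torus.lift (u t))
        (fun t => FunctionSpaces.Torus.lift (p t)) →
      FunctionSpaces.Torus.HasZeroMean (u 0) →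
      FunctionSpaces.Torus.gradNormSq (u 0) / (8 * Real.pi ^ 2 * c * ν ^ 3) < T →
      (∀ t ∈ Icc 0 b, t ≤ T → FunctionSpaces.Torus.gradNormSq (u t) ≤ B) →
      ∀ t ∈ Icc 0 b, FunctionSpaces.Torus.gradNormSq (u t) ≤ max B (c * ν ^ 2) := by
  obtain ⟨c, hc, hev⟩ := torus_gradNormSq_lt_of_energy
  refine ⟨c, hc, ?_⟩
  intro ν Ω b T B u p hν h h0 hT hlayer t ht
  by_cases htT : t ≤ T
  · exact (hlayer t ht htT).trans (le_max_left _ _)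
  · -- `t > T`: eventual smallness from the energy at time `0`
    have hTt : T < t := not_le.1 htT
    have hTpos : 0 < T := by
      refine lt_of_le_of_lt ?_ hT
      exact div_nonneg (FunctionSpaces.Torus.gradNormSq_nonneg _) (by positivity)
    have hTb : T ≤ b := hTt.le.trans ht.2
    -- Poincaré: `½‖u 0‖² ≤ ‖∇u 0‖²/(8π²)`, hence `kineticEnergy (u 0) < c ν³ T`
    have h' : IsClassicalNSCoriolisSolutionOn (Icc 0 b) ν Ω
        (fun t => FunctionSpaces.Torus.lift
          ((0 : ℝ → UnitAddTorus (Fin 3) → EuclideanSpace ℝ (Fin 3)) t))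
        (fun t => FunctionSpaces.Torus.lift (u t)) (fun t => FunctionSpaces.Torus.lift (p t)) := h
    have hsm : FunctionSpaces.Torus.IsSmooth (u 0) :=
      h'.to_torus.smooth_velocity.isSmooth_slice (left_mem_Icc.2 (hTpos.le.trans hTb))
    have hP := Torus.integral_norm_sq_le_gradNormSq_of_hasZeroMean hsm h0
    have hE : FunctionSpaces.Torus.kineticEnergy (u 0) < c * ν ^ 3 * T := by
      rw [FunctionSpaces.Torus.kineticEnergy]
      have hπ : 0 < 8 * Real.pi ^ 2 := by positivity
      rw [div_lt_iff₀ (by positivity)] at hT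
      nlinarith
    exact (hev hν h hTpos hTb hE t ⟨hTt.le, ht.2⟩).le.trans (le_max_right _ _)

end IsClassicalNSCoriolisSolutionOn

end Literature.Analysis.FluidPDE

end
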